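import Mathlib
import Summits.Ventures.HodgeRepro2.A2GaloisDescent
import Summits.Ventures.HodgeRepro2.A1EigenlinePermutation
import Summits.Ventures.HodgeRepro2.A1ExteriorBaseChange
import Summits.Ventures.HodgeRepro2.A1GaloisTensorSplitting
import Summits.Ventures.HodgeRepro2.A1EigenlineDecompositionGalois
import Summits.Ventures.HodgeRepro2.A1SplitSummandDescent
import Summits.Ventures.HodgeRepro2.A1EigenlineDimension
import Summits.Ventures.HodgeRepro2.A1DescendedSurjection

/-!
# The descended subspace IS `⋀^n_F V`: `π : W₀ → ⋀^n_F V` is bijective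

Blind cell `pub-hodge-repro2`, seat p7 (gen 10), A1 annex (route/T4-A1-p7.md, Lemma A1.3's first
sentence; route/LEAN-ANNEX-p7.md §4, clause (ii)).  `A1DescendedSurjection` proved that the
canonical surjection `π : ⋀^n_K V → ⋀^n_F V` maps the descended `W₀` (with `W₀ ⊗ L = ⊕_σ ⋀^n V_σ`)
ONTO `⋀^n_F V`.  This file proves INJECTIVITY, completing the identification of the descended
subspace with Deligne's `∧^n_F V`:

* after base change, `Φ` maps each piece `E_σ = ⋀^n_L V_σ` into the `σ`-eigenline of
  `L ⊗ ⋀^n_F V` (`map_pieceSummand_le`), and in fact ONTO it (`map_pieceSummand_eq`: the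
  `σ`-component of a surjective image is the image of the `σ`-piece, `ρ_idem_Φ_sum`);
* both have dimension `C(dim_F V, n)` (`finrank_pieceSummand`, `finrank_eigenline_exterior`,
  from `A1EigenlineDimension`), so `Φ` is injective on each piece (`eq_zero_of_mem_pieceSummand`);
* the eigenlines of the target are independent, so `Φ` is injective on the whole split summand
  (`eq_zero_of_mem_eigenSummand`) — no independence of the pieces `E_σ` is needed;
* descending, `π` is injective on `W₀` (`restrictMap_eq_zero_of_mem`), hence
  **`bijective_restrictMap_comp_subtype`** and **`exists_descended_bijective`**:
  there is `W₀ ⊆ ⋀^n_K V` with `W₀ ⊗ L = ⊕_σ ⋀^n V_σ` and `π|_{W₀} : W₀ ≃ ⋀^n_F V`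
  (`descendedEquiv`); `exists_descended_bijective_self` is the case `L = F`, `F/K` Galois;
* Deligne's inclusion itself, `deligneIncl : ⋀^n_F V → ⋀^n_K V` (a section of `π` with image
  `W₀`), the dimension `dim_K W₀ = [F : K] · C(dim_F V, n)` (`finrank_descended`; for the top
  power, `dim_K W₀ = [F : K]` — «`W_F(B)` is an `F`-line», `finrank_descended_top`), and the
  direct-summand property `IsCompl (⊕_σ ⋀^n V_σ) (ker Φ)` (`isCompl_eigenSummand_ker`).

This is Lemma A1.3's first sentence in full (Deligne's inclusion `∧^n_F V ⊂ ∧^n_K V` is the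
inverse of `π|_{W₀}`), for any `K`-space `V` with an `F`-action, finite-dimensional over `F`.
What stays prose (A1 §4): only the geometry (`V = H¹(B, ℚ)`).

README §8(d): uses an L-value-free non-vanishing device: NO.
-/

namespace Summit.Ventures.HodgeRepro2.A1DescendedBijection

open TensorProduct
open Summit.Ventures.HodgeRepro2.A1EigenlinePermutation
open Summit.Ventures.HodgeRepro2.A1ExteriorBaseChange
open Summit.Ventures.HodgeRepro2.A1GaloisTensorSplitting
open Summit.Ventures.HodgeRepro2.A1EigenlineDecompositionGalois
open Summit.Ventures.HodgeRepro2.A1SplitSummandDescent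
open Summit.Ventures.HodgeRepro2.A1EigenlineDimension
open Summit.Ventures.HodgeRepro2.A1DescendedSurjection

section Pieces

variable (K L : Type*) [Field K] [Field L] [Algebra K L]
variable (F : Type*) [Field F] [Algebra K F] [FiniteDimensional K F]
variable (V : Type*) [AddCommGroup V] [Module K V] [Module F V] [IsScalarTower K F V]
variable (n : ℕ) [NeZero n] {I : Type*} [LinearOrder I] (b : Module.Basis I K V)
variable [Fintype (Emb K L F)] [DecidableEq (Emb K L F)]

/-- The `σ`-piece `E_σ = ⋀^n_L V_σ ⊆ ⋀^n_L (L ⊗ V)` of the split summand. -/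
noncomputable abbrev pieceSummand (σ : Emb K L F) : Submodule L (⋀[L]^n (L ⊗[K] V)) :=
  LinearMap.range (exteriorPower.map (M := eigenline L V σ) n (eigenline L V σ).subtype)

omit [FiniteDimensional K F] [NeZero n] [Fintype (Emb K L F)] [DecidableEq (Emb K L F)] in
/-- The split summand is the sum of its pieces (by definition). -/
theorem eigenSummand_eq_iSup : eigenSummand K L F V n = ⨆ σ, pieceSummand K L F V n σ := by
  simp only [eigenSummand, splitSummand, pieceSummand]

omit [FiniteDimensional K F] [Fintype (Emb K L F)] [DecidableEq (Emb K L F)] in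
/-- `Φ` maps the piece `E_σ` into the `σ`-eigenline of `L ⊗ ⋀^n_F V`. -/
theorem map_pieceSummand_le (σ : Emb K L F) :
    (pieceSummand K L F V n σ).map (Φ K L F V n b) ≤ eigenline L (⋀[F]^n V) σ := by
  rw [pieceSummand, range_map_subtype_eq_span, Submodule.map_span, Submodule.span_le]
  rintro _ ⟨_, ⟨w, hw, rfl⟩, rfl⟩
  exact Φ_ιMulti_mem_eigenline K L F V n b σ w hw

/-- The `σ`-component of `Φ (∑_τ z_τ)`, `z_τ ∈ E_τ`, is `Φ z_σ`. -/
theorem ρ_idem_Φ_sum (hcard : Fintype.card (Emb K L F) = Module.finrank K F)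
    (f : Emb K L F →₀ ⋀[L]^n (L ⊗[K] V)) (hf : ∀ τ, f τ ∈ pieceSummand K L F V n τ)
    (σ : Emb K L F) :
    ρ K L F (⋀[F]^n V) (idem K L F hcard σ) (Φ K L F V n b (f.sum fun _ x => x)) =
      Φ K L F V n b (f σ) := by
  rw [map_finsuppSum, map_finsuppSum]
  have h : ∀ τ, ρ K L F (⋀[F]^n V) (idem K L F hcard σ) (Φ K L F V n b (f τ)) =
      if τ = σ then Φ K L F V n b (f τ) else 0 := fun τ =>
    ρ_idem_apply_of_mem_eigenline K L F (⋀[F]^n V) hcard σ τ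
      (map_pieceSummand_le K L F V n b τ ⟨f τ, hf τ, rfl⟩)
  rw [Finsupp.sum_congr (g2 := fun τ x => if τ = σ then Φ K L F V n b x else 0) (fun τ _ => h τ),
    Finsupp.sum_ite_eq']
  split_ifs with hσ
  · rfl
  · rw [Finsupp.notMem_support_iff.mp hσ, map_zero]

/-- `Φ` maps the piece `E_σ` ONTO the `σ`-eigenline of `L ⊗ ⋀^n_F V`. -/
theorem map_pieceSummand_eq (hcard : Fintype.card (Emb K L F) = Module.finrank K F)
    (σ : Emb K L F) :
    (pieceSummand K L F V n σ).map (Φ K L F V n b) = eigenline L (⋀[F]^n V) σ := by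
  refine le_antisymm (map_pieceSummand_le K L F V n b σ) ?_
  intro y hy
  have hy' : y ∈ (eigenSummand K L F V n).map (Φ K L F V n b) := by
    rw [map_eigenSummand_Φ K L F V n b hcard]; exact Submodule.mem_top
  obtain ⟨z, hz, rfl⟩ := hy'
  have hz' : z ∈ ⨆ σ, pieceSummand K L F V n σ := by rwa [← eigenSummand_eq_iSup]
  rw [Submodule.mem_iSup_iff_exists_finsupp] at hz'
  obtain ⟨f, hf, rfl⟩ := hz'
  have h1 := ρ_idem_apply_of_mem_eigenline K L F (⋀[F]^n V) hcard σ σ hy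
  rw [if_pos rfl, ρ_idem_Φ_sum K L F V n b hcard f hf σ] at h1
  exact ⟨f σ, hf σ, h1⟩

variable [FiniteDimensional F V]

omit [NeZero n] in
/-- `dim_L E_σ = C(dim_F V, n)`. -/
theorem finrank_pieceSummand (hcard : Fintype.card (Emb K L F) = Module.finrank K F)
    (σ : Emb K L F) :
    Module.finrank L (pieceSummand K L F V n σ) = (Module.finrank F V).choose n := by
  haveI : FiniteDimensional K V := Module.Finite.trans F V
  haveI : FiniteDimensional L (L ⊗[K] V) := Module.Finite.base_change K L V
  haveI : FiniteDimensional L (eigenline L V σ) := FiniteDimensional.finiteDimensional_submodule _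
  haveI : Module.Free L (eigenline L V σ) := Module.Free.of_divisionRing L (eigenline L V σ)
  rw [pieceSummand, LinearMap.finrank_range_of_inj
    (exteriorPower.map_injective_field (Submodule.injective_subtype _)),
    exteriorPower.finrank_eq, finrank_eigenline K L F V hcard σ]

omit [NeZero n] in
/-- `dim_L` of the `σ`-eigenline of `L ⊗ ⋀^n_F V` is `C(dim_F V, n)`. -/
theorem finrank_eigenline_exterior (hcard : Fintype.card (Emb K L F) = Module.finrank K F)
    (σ : Emb K L F) :
    Module.finrank L (eigenline L (⋀[F]^n V) σ) = (Module.finrank F V).choose n := by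
  haveI : Module.Free F (⋀[F]^n V) := Module.Free.of_divisionRing F (⋀[F]^n V)
  rw [finrank_eigenline K L F (⋀[F]^n V) hcard σ, exteriorPower.finrank_eq]

/-- **`Φ` is injective on each piece `E_σ`** (it maps `E_σ` onto the `σ`-eigenline, which has the
same finite dimension; Mathlib's `Submodule.disjoint_ker_of_finrank_le`). -/
theorem eq_zero_of_mem_pieceSummand (hcard : Fintype.card (Emb K L F) = Module.finrank K F)
    (σ : Emb K L F) {z : ⋀[L]^n (L ⊗[K] V)} (hz : z ∈ pieceSummand K L F V n σ)
    (h0 : Φ K L F V n b z = 0) : z = 0 := by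
  haveI : FiniteDimensional K V := Module.Finite.trans F V
  haveI : FiniteDimensional L (L ⊗[K] V) := Module.Finite.base_change K L V
  haveI : FiniteDimensional L (pieceSummand K L F V n σ) :=
    FiniteDimensional.finiteDimensional_submodule _
  have hle : Module.finrank L (pieceSummand K L F V n σ) ≤
      Module.finrank L ((pieceSummand K L F V n σ).map (Φ K L F V n b)) := by
    rw [map_pieceSummand_eq K L F V n b hcard σ, finrank_pieceSummand K L F V n hcard σ,
      finrank_eigenline_exterior K L F V n hcard σ]
  have hdisj := Submodule.disjoint_ker_of_finrank_le (Φ K L F V n b) hle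
  exact (Submodule.disjoint_def.mp hdisj) z hz (LinearMap.mem_ker.mpr h0)

/-- **`Φ` is injective on the split summand** (the eigenlines of the target are independent). -/
theorem eq_zero_of_mem_eigenSummand (hcard : Fintype.card (Emb K L F) = Module.finrank K F)
    {z : ⋀[L]^n (L ⊗[K] V)} (hz : z ∈ eigenSummand K L F V n) (h0 : Φ K L F V n b z = 0) :
    z = 0 := by
  rw [eigenSummand_eq_iSup] at hz
  rw [Submodule.mem_iSup_iff_exists_finsupp] at hz
  obtain ⟨f, hf, rfl⟩ := hz
  have hcomp : ∀ τ, Φ K L F V n b (f τ) = 0 := fun τ => by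
    have h1 := ρ_idem_Φ_sum K L F V n b hcard f hf τ
    rwa [h0, map_zero, eq_comm] at h1
  have hzero : ∀ τ, f τ = 0 := fun τ =>
    eq_zero_of_mem_pieceSummand K L F V n b hcard τ (hf τ) (hcomp τ)
  have : f = 0 := Finsupp.ext hzero
  rw [this, Finsupp.sum_zero_index]

/-- **The split summand is a direct summand of `⋀^n_L (L ⊗ V)`**, complemented by `ker Φ`
(the «evident direct summand» of Deligne 4.3(b), in the intrinsic form). -/
theorem isCompl_eigenSummand_ker (hcard : Fintype.card (Emb K L F) = Module.finrank K F) :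
    IsCompl (eigenSummand K L F V n) (LinearMap.ker (Φ K L F V n b)) := by
  constructor
  · rw [Submodule.disjoint_def]
    intro z hz hk
    exact eq_zero_of_mem_eigenSummand K L F V n b hcard hz (LinearMap.mem_ker.mp hk)
  · rw [codisjoint_iff, eq_top_iff]
    intro z _
    have hz : Φ K L F V n b z ∈ (eigenSummand K L F V n).map (Φ K L F V n b) := by
      rw [map_eigenSummand_Φ K L F V n b hcard]; exact Submodule.mem_top
    obtain ⟨z', hz', hzz'⟩ := hz
    rw [Submodule.mem_sup]
    exact ⟨z', hz', z - z', by rw [LinearMap.mem_ker, map_sub, hzz', sub_self], by abel⟩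

end Pieces

section Descent

variable (K L : Type*) [Field K] [Field L] [Algebra K L]
variable (F : Type*) [Field F] [Algebra K F] [FiniteDimensional K F]
variable (V : Type*) [AddCommGroup V] [Module K V] [Module F V] [IsScalarTower K F V]
  [FiniteDimensional F V]
variable (n : ℕ) [NeZero n] {I : Type*} [LinearOrder I] (b : Module.Basis I K V)
variable [Fintype (Emb K L F)] [DecidableEq (Emb K L F)]

/-- **`π` is injective on the descended subspace.** -/
theorem restrictMap_eq_zero_of_mem (hcard : Fintype.card (Emb K L F) = Module.finrank K F)
    (W₀ : Submodule K (⋀[K]^n V)) (hW₀ : W₀.baseChange L = eigenSummandK K L F V n b)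
    {w : ⋀[K]^n V} (hw : w ∈ W₀) (h0 : restrictMap K F V n w = 0) : w = 0 := by
  have h1 : (1 : L) ⊗ₜ[K] w ∈ W₀.baseChange L := Submodule.tmul_mem_baseChange_of_mem 1 hw
  rw [hW₀, mem_eigenSummandK_iff] at h1
  have h2 : Φ K L F V n b (baseChangeEquiv K L V n b ((1 : L) ⊗ₜ[K] w)) = 0 := by
    rw [Φ, LinearMap.comp_apply, LinearEquiv.coe_coe, LinearEquiv.symm_apply_apply,
      LinearMap.baseChange_tmul, h0, TensorProduct.tmul_zero]
  have h3 := eq_zero_of_mem_eigenSummand K L F V n b hcard h1 h2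
  rw [LinearEquiv.map_eq_zero_iff] at h3
  exact Summit.Ventures.HodgeRepro2.A2GaloisDescent.eq_of_one_tmul_eq
    (h3.trans (TensorProduct.tmul_zero (R := K) (⋀[K]^n V) (1 : L)).symm)

/-- **`π|_{W₀} : W₀ → ⋀^n_F V` is bijective** whenever `W₀ ⊗ L` is the split summand. -/
theorem bijective_restrictMap_comp_subtype (hcard : Fintype.card (Emb K L F) = Module.finrank K F)
    (W₀ : Submodule K (⋀[K]^n V)) (hW₀ : W₀.baseChange L = eigenSummandK K L F V n b) :
    Function.Bijective ((restrictMap K F V n).comp W₀.subtype) := by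
  constructor
  · rw [injective_iff_map_eq_zero]
    rintro ⟨w, hw⟩ h0
    exact Subtype.ext (restrictMap_eq_zero_of_mem K L F V n b hcard W₀ hW₀ hw h0)
  · intro y
    have hy : y ∈ W₀.map (restrictMap K F V n) := by
      rw [restrictMap_map_eq_top_of_baseChange_eq K L F V n b hcard W₀ hW₀]
      exact Submodule.mem_top
    obtain ⟨w, hw, rfl⟩ := hy
    exact ⟨⟨w, hw⟩, rfl⟩

/-- The identification `W₀ ≃ₗ[K] ⋀^n_F V` given by `π` (Deligne's inclusion is its inverse). -/
noncomputable def descendedEquiv (hcard : Fintype.card (Emb K L F) = Module.finrank K F)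
    (W₀ : Submodule K (⋀[K]^n V)) (hW₀ : W₀.baseChange L = eigenSummandK K L F V n b) :
    W₀ ≃ₗ[K] ⋀[F]^n V :=
  LinearEquiv.ofBijective _ (bijective_restrictMap_comp_subtype K L F V n b hcard W₀ hW₀)

/-- **Deligne's inclusion `∧^n_F V ⊂ ∧^n_K V`**: the inverse of `π|_{W₀}` followed by the inclusion
of `W₀` — a `K`-linear section of `π` with image `W₀`. -/
noncomputable def deligneIncl (hcard : Fintype.card (Emb K L F) = Module.finrank K F)
    (W₀ : Submodule K (⋀[K]^n V)) (hW₀ : W₀.baseChange L = eigenSummandK K L F V n b) :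
    ⋀[F]^n V →ₗ[K] ⋀[K]^n V :=
  W₀.subtype ∘ₗ (descendedEquiv K L F V n b hcard W₀ hW₀).symm.toLinearMap

/-- `π ∘ deligneIncl = id`: Deligne's inclusion is a section of the canonical surjection. -/
theorem restrictMap_comp_deligneIncl (hcard : Fintype.card (Emb K L F) = Module.finrank K F)
    (W₀ : Submodule K (⋀[K]^n V)) (hW₀ : W₀.baseChange L = eigenSummandK K L F V n b) :
    restrictMap K F V n ∘ₗ deligneIncl K L F V n b hcard W₀ hW₀ = LinearMap.id := by
  apply LinearMap.ext
  intro y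
  have h := (descendedEquiv K L F V n b hcard W₀ hW₀).apply_symm_apply y
  rw [deligneIncl, LinearMap.comp_apply, LinearMap.comp_apply, LinearMap.id_apply]
  exact h

/-- The image of Deligne's inclusion is the descended subspace `W₀`. -/
theorem range_deligneIncl (hcard : Fintype.card (Emb K L F) = Module.finrank K F)
    (W₀ : Submodule K (⋀[K]^n V)) (hW₀ : W₀.baseChange L = eigenSummandK K L F V n b) :
    LinearMap.range (deligneIncl K L F V n b hcard W₀ hW₀) = W₀ := by
  rw [deligneIncl, LinearMap.range_comp, LinearEquiv.range, Submodule.map_subtype_top]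

/-- `dim_K W₀ = [F : K] · C(dim_F V, n)` — the dimension of Deligne's `∧^n_F V` as a `K`-space. -/
theorem finrank_descended (hcard : Fintype.card (Emb K L F) = Module.finrank K F)
    (W₀ : Submodule K (⋀[K]^n V)) (hW₀ : W₀.baseChange L = eigenSummandK K L F V n b) :
    Module.finrank K W₀ = Module.finrank K F * (Module.finrank F V).choose n := by
  haveI : Module.Free F (⋀[F]^n V) := Module.Free.of_divisionRing F (⋀[F]^n V)
  rw [LinearEquiv.finrank_eq (descendedEquiv K L F V n b hcard W₀ hW₀),
    ← Module.finrank_mul_finrank K F (⋀[F]^n V), exteriorPower.finrank_eq]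

/-- **Lemma A1.3, first sentence, in full**: for `L/K` finite Galois receiving all embeddings of
`F`, there is a `K`-subspace `W₀ ⊆ ⋀^n_K V` with `W₀ ⊗ L = ⊕_σ ⋀^n_L V_σ` on which the canonical
surjection `π : ⋀^n_K V → ⋀^n_F V` restricts to an isomorphism `W₀ ≃ ⋀^n_F V` — Deligne's
`∧^n_F V ⊂ ∧^n_K V`, constructed by descent from the split case. -/
theorem exists_descended_bijective [FiniteDimensional K L] [IsGalois K L]
    (hcard : Fintype.card (Emb K L F) = Module.finrank K F) :
    ∃ W₀ : Submodule K (⋀[K]^n V), W₀.baseChange L = eigenSummandK K L F V n b ∧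
      Function.Bijective ((restrictMap K F V n).comp W₀.subtype) := by
  obtain ⟨W₀, hW₀⟩ := exists_baseChange_eq_eigenSummandK K L F V n b
  exact ⟨W₀, hW₀, bijective_restrictMap_comp_subtype K L F V n b hcard W₀ hW₀⟩

end Descent

section GaloisSelf

variable (K F : Type*) [Field K] [Field F] [Algebra K F] [FiniteDimensional K F] [IsGalois K F]
variable (V : Type*) [AddCommGroup V] [Module K V] [Module F V] [IsScalarTower K F V]
  [FiniteDimensional F V]
variable (n : ℕ) [NeZero n] {I : Type*} [LinearOrder I] (b : Module.Basis I K V)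

/-- **Over the Galois CM field itself** (`L = F`): `W₀ ⊆ ⋀^n_K V` with
`W₀ ⊗ F = ⊕_{σ : F → F} ⋀^n V_σ` and `π|_{W₀} : W₀ ≃ ⋀^n_F V`. -/
theorem exists_descended_bijective_self [DecidableEq (Emb K F F)] :
    ∃ W₀ : Submodule K (⋀[K]^n V), W₀.baseChange F = eigenSummandK K F F V n b ∧
      Function.Bijective ((restrictMap K F V n).comp W₀.subtype) :=
  exists_descended_bijective K F F V n b (card_algHom_self K F)

/-- **The top exterior power is an `F`-line**: for `n = dim_F V` the descended `W₀ ⊆ ⋀^n_K V`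
(`W_F(B) = ∧^{top}_F H¹(B, ℚ)` in A1) has `K`-dimension `[F : K]`. -/
theorem finrank_descended_top [DecidableEq (Emb K F F)] [NeZero (Module.finrank F V)]
    (b : Module.Basis I K V) (W₀ : Submodule K (⋀[K]^(Module.finrank F V) V))
    (hW₀ : W₀.baseChange F = eigenSummandK K F F V (Module.finrank F V) b) :
    Module.finrank K W₀ = Module.finrank K F := by
  rw [finrank_descended K F F V (Module.finrank F V) b (card_algHom_self K F) W₀ hW₀,
    Nat.choose_self, mul_one]

end GaloisSelf

end Summit.Ventures.HodgeRepro2.A1DescendedBijection
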